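import Summits.KontsevichZagierPeriods.Zeta5Search.LaiSweepShard

/-!
# `κ₃` sweep certificate — shard file 008 of 127 (shards 56–62 of 889)

HONEST FRAMING. Systematic search; no irrationality claim unless certified. This file only checks,
by `decide +kernel`, shards 56–62 of the order-cell sweep of the `κ₃` point `(74, 2180, 444; δ74)`
(engine `LaiSweepEngine`, soundness `LaiSweepJump/Free/Eval/Shard/Kappa3`; a shard is `⟨regime, n,
p, q, p', q', Lo, Up⟩`: `n` cells from `p/q` to `p'/q'` with integer rate sums in `[Lo, Up]`, `K =
128`, `D = 2^40`). It draws NO conclusion: only the capstone `LaiKappa3SweepCert`, which needs all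
127 shard files, does. Kernel cost of this file ≈ 560 cells × 0.3 s.
-/

namespace Summit.KontsevichZagierPeriods.Zeta5Search.Sweep

set_option maxHeartbeats 100000000 in
/-- Shard 56: 80 cells of regime A from `3/193` to `19/1201`.
[cite: Lai2024BallRivoal, §4 Lemma 4.3] -/
theorem shard056 :
    Shard.check 128 (2^40)
      ⟨false, 80, 3, 193, 19, 1201, 113878966888224, 113929124028063⟩ = true := by
  decide +kernel

set_option maxHeartbeats 100000000 in
/-- Shard 57: 80 cells of regime A from `19/1201` to `14/871`.
[cite: Lai2024BallRivoal, §4 Lemma 4.3] -/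
theorem shard057 :
    Shard.check 128 (2^40)
      ⟨false, 80, 19, 1201, 14, 871, 101937788769941, 101976367776991⟩ = true := by
  decide +kernel

set_option maxHeartbeats 100000000 in
/-- Shard 58: 80 cells of regime A from `14/871` to `5/306`.
[cite: Lai2024BallRivoal, §4 Lemma 4.3] -/
theorem shard058 :
    Shard.check 128 (2^40)
      ⟨false, 80, 14, 871, 5, 306, 112673958235516, 112719876875365⟩ = true := by
  decide +kernel

set_option maxHeartbeats 100000000 in
/-- Shard 59: 80 cells of regime A from `5/306` to `5/302`.
[cite: Lai2024BallRivoal, §4 Lemma 4.3] -/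
theorem shard059 :
    Shard.check 128 (2^40)
      ⟨false, 80, 5, 306, 5, 302, 94704313577816, 94739598824915⟩ = true := by
  decide +kernel

set_option maxHeartbeats 100000000 in
/-- Shard 60: 80 cells of regime A from `5/302` to `19/1130`.
[cite: Lai2024BallRivoal, §4 Lemma 4.3] -/
theorem shard060 :
    Shard.check 128 (2^40)
      ⟨false, 80, 5, 302, 19, 1130, 108959065715353, 109011729330166⟩ = true := by
  decide +kernel

set_option maxHeartbeats 100000000 in
/-- Shard 61: 80 cells of regime A from `19/1130` to `19/1117`.
[cite: Lai2024BallRivoal, §4 Lemma 4.3] -/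
theorem shard061 :
    Shard.check 128 (2^40)
      ⟨false, 80, 19, 1130, 19, 1117, 80023253001278, 80049300232549⟩ = true := by
  decide +kernel

set_option maxHeartbeats 100000000 in
/-- Shard 62: 80 cells of regime A from `19/1117` to `22/1275`.
[cite: Lai2024BallRivoal, §4 Lemma 4.3] -/
theorem shard062 :
    Shard.check 128 (2^40)
      ⟨false, 80, 19, 1117, 22, 1275, 96749760424581, 96786752073681⟩ = true := by
  decide +kernel

/-- The checked shards of this file, in order. [folklore] -/
def shards008 : List (CheckedShard 128 (2^40)) :=
  [⟨_, shard056⟩, ⟨_, shard057⟩, ⟨_, shard058⟩, ⟨_, shard059⟩, ⟨_, shard060⟩,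
    ⟨_, shard061⟩, ⟨_, shard062⟩]

end Summit.KontsevichZagierPeriods.Zeta5Search.Sweep
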